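import Summits.QuantumFields.YangMills.Theorems.F4SubCurvatureDoorHexagonNormalFormDefs
import HarnessLib

/-!
# Route `F4SubCurvatureDoor`, crux stmt-QuantumFields-23125 `RationalToGeneral`, crux idea `hexagon-normal-form`:
# the first lemma (O3) `GrowthO3` and the square contrast `SquareAnalogueFails` — PROVED

Support lemmas toward the OPEN finite-type hexagon conjecture (`HexagonNormalForm.FiniteTypeHexagon`, a `def`) of the route owner's crux
idea card `hexagon-normal-form` (planner `ym-idea-3` g15; free-hands menu 2026-08-28T19:16:20Z, items (m1) and (m2)), over the typed objects of
the D-0016 Defs companion `F4SubCurvatureDoorHexagonNormalFormDefs.lean` (p660858):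

* (m2) **`squareAnalogueFails : SquareAnalogueFails`** — Prop. B in one variable: the pair `F = (3/2)w² + 3w + 2`, `G = −1/2` is real entire,
  `G ≢ 0`, and satisfies the SQUARE (`W(B₄)`, 90°) Wick condition `WickSquare`: `F + (w² − 8sw + 8s²)G = w² + (3+4s)w + (2 − 4s²)` has, for every
  `s ≥ 0`, only real zeros `≤ s` (`square_quadratic_roots`: imaginary part `b(2a + 3 + 4s) = 0`, and `b ≠ 0` would force
  `b² = −(32s² + 24s + 1)/4 < 0`; a real zero `a > s` would give `a² + (3+4s)a + 2 − 4s² > s² + 3s + 2 > 0`).  So the square analogue of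
  the hexagon rigidity is FALSE — the contrast the card records (the 60° half-integer short roots are used at the first step).
* (m1) **`growthO3 : GrowthO3`** — (O3), the card's typed FIRST LEMMA: for real entire `F, G` with the hexagon Wick condition `WickHexagon F G`
  (all zeros of `F + P_s G` real and `≤ s`, every `s ≥ 0`), `x³‖G x‖ ≤ ‖F x‖` for every `x > 0`.  Proof: `s ↦ P_s(x) = (x−2s)(x²−16sx+16s²)` is a
  real polynomial with `P_0(x) = x³`, `P_x(x) = −x³` (`P_ofReal`); `F x`, `G x` are real (`IsRealEntire.apply_ofReal`); if `|F x| < x³|G x|` then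
  `−F x/G x ∈ (−x³, x³)` is a value `P_s(x)`, `s ∈ [0, x]` (intermediate value theorem), making `x` a zero of `Φ_s` with `x > s` unless `s = x`,
  and `s = x` gives `|F x/G x| = x³` — contradiction.

Honest label: elementary support lemmas; the conjecture `FiniteTypeHexagon`, (O2) `RealRootedO2` (Hurwitz), the crux 23125, the route's rung and every
summit statement are NOT proved here.  No named facts; no `sorry`; default heartbeats.  Seat `ym-line-frs-p2` g9 (free hands, announced on the owner's
bus 19:20Z), `--supports stmt-QuantumFields-23125`.
-/

noncomputable section

namespace Summit.QuantumFields.YangMills.Cruxes.RationalToGeneral.HexagonNormalForm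

open Set

/-! ## (m2) The square (`W(B₄)`, 90°) analogue admits a non-trivial pair -/

/-- The quadratic `Φ_s(z) = z² + (3+4s)z + (2 − 4s²)` has only real roots, all `≤ s`, for every `s ≥ 0`
(discriminant `32s² + 24s + 1 > 0`; larger root `≤ s ⇔ 4s² + 12s + 8 ≥ 0`). -/
theorem square_quadratic_roots {s : ℝ} (hs : 0 ≤ s) {z : ℂ}
    (hz : z ^ 2 + (3 + 4 * (s : ℂ)) * z + (2 - 4 * (s : ℂ) ^ 2) = 0) : z.im = 0 ∧ z.re ≤ s := by
  have hre := congrArg Complex.re hz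
  have him := congrArg Complex.im hz
  simp only [Complex.add_re, Complex.mul_re, Complex.sub_re, Complex.add_im, Complex.mul_im, Complex.sub_im,
    pow_two, Complex.ofReal_re, Complex.ofReal_im, Complex.zero_re, Complex.zero_im, Complex.re_ofNat,
    Complex.im_ofNat, mul_zero, sub_zero, zero_mul, add_zero] at hre him
  -- `him : b(2a + 3 + 4s) = 0`, `hre : a² − b² + (3+4s)a + 2 − 4s² = 0`
  have hb : z.im = 0 := by
    by_contra hb
    have h2a : 2 * z.re + 3 + 4 * s = 0 := by
      have hfac : z.im * (2 * z.re + 3 + 4 * s) = 0 := by nlinarith [him]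
      exact (mul_eq_zero.1 hfac).resolve_left hb
    nlinarith [sq_nonneg z.im, mul_self_pos.2 hb]
  refine ⟨hb, ?_⟩
  rw [hb] at hre
  by_contra hgt
  have hgt' : s < z.re := lt_of_not_ge hgt
  have h1 : (3 + 4 * s) * s < (3 + 4 * s) * z.re := mul_lt_mul_of_pos_left hgt' (by linarith)
  nlinarith [mul_pos (lt_of_le_of_lt hs hgt') (lt_of_le_of_lt hs hgt')]

/-- **`SquareAnalogueFails`** — Prop. B in one variable: `F = (3/2)w² + 3w + 2`, `G = −1/2` is a real-entire pair with
`G ≢ 0` satisfying the square Wick condition `WickSquare` (`F + (w² − 8sw + 8s²)G = w² + (3+4s)w + 2 − 4s²`). -/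
theorem squareAnalogueFails : SquareAnalogueFails := by
  refine ⟨fun z => (3 / 2) * z ^ 2 + 3 * z + 2, fun _ => -(1 / 2), ⟨by fun_prop, fun z => ?_⟩,
    ⟨differentiable_const _, fun z => ?_⟩, fun s hs z hz => ?_, ⟨0, by norm_num⟩⟩
  · simp only [map_add, map_mul, map_pow, map_ofNat, map_div₀]
  · simp only [map_neg, map_div₀, map_one, map_ofNat]
  · refine square_quadratic_roots hs ?_
    linear_combination hz

/-! ## (m1) `GrowthO3`: forbidden real zeros at `w > s` force `x³‖G x‖ ≤ ‖F x‖` on the positive axis -/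

/-- `P_s` is real on the real axis: `P s x = (x − 2s)(x² − 16sx + 16s²)` as a real number. -/
theorem P_ofReal (s x : ℝ) : P s (x : ℂ) = (((x - 2 * s) * (x ^ 2 - 16 * s * x + 16 * s ^ 2) : ℝ) : ℂ) := by
  simp only [P]
  push_cast
  ring

/-- A real-entire function is real on the real axis: `F x = Re(F x)`. -/
theorem IsRealEntire.apply_ofReal {F : ℂ → ℂ} (hF : IsRealEntire F) (x : ℝ) : F (x : ℂ) = ((F (x : ℂ)).re : ℂ) := by
  have h := hF.2 (x : ℂ)
  rw [Complex.conj_ofReal] at h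
  -- `h : F x = conj (F x)`
  exact (Complex.conj_eq_iff_re.1 h.symm).symm

/-- **(O3)** `GrowthO3`: if `F, G` are real entire and `F + P_s G` has, for every `s ≥ 0`, only real zeros `≤ s`, then
`x³‖G x‖ ≤ ‖F x‖` for every `x > 0`.  Proof: `s ↦ P_s(x)` is a real polynomial with `P_0(x) = x³`, `P_x(x) = −x³`; if
`|F x| < x³|G x|` the real number `−F x/G x` lies in `(−x³, x³)`, so by the intermediate value theorem it equals `P_s(x)` for some
`s ∈ [0, x]`, i.e. `x` is a zero of `Φ_s`; the Wick condition forces `x ≤ s`, hence `s = x` and `−F x/G x = −x³` — contradiction. -/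
theorem growthO3 : GrowthO3 := by
  intro F G hF hG hW x hx
  by_contra hlt
  have hlt' : ‖F (x : ℂ)‖ < x ^ 3 * ‖G (x : ℂ)‖ := lt_of_not_ge hlt
  -- real values on the axis
  set f : ℝ := (F (x : ℂ)).re with hf
  set g : ℝ := (G (x : ℂ)).re with hg
  have hFx : F (x : ℂ) = (f : ℂ) := hF.apply_ofReal x
  have hGx : G (x : ℂ) = (g : ℂ) := hG.apply_ofReal x
  rw [hFx, hGx, Complex.norm_real, Complex.norm_real, Real.norm_eq_abs, Real.norm_eq_abs] at hlt'
  have hx3 : 0 < x ^ 3 := by positivity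
  have hg0 : g ≠ 0 := by
    intro h0
    rw [h0, abs_zero, mul_zero] at hlt'
    exact (abs_nonneg f).not_gt hlt'
  -- the target value `r = −f/g ∈ (−x³, x³)`
  set r : ℝ := -f / g with hr
  have hr_abs : |r| < x ^ 3 := by
    rw [hr, abs_div, abs_neg, div_lt_iff₀ (abs_pos.2 hg0)]
    linarith
  have hr_mem : r ∈ Icc (-(x ^ 3)) (x ^ 3) := ⟨(abs_lt.1 hr_abs).1.le, (abs_lt.1 hr_abs).2.le⟩
  -- the real polynomial `φ(s) = P_s(x)` and the intermediate value theorem on `[0, x]`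
  set φ : ℝ → ℝ := fun s => (x - 2 * s) * (x ^ 2 - 16 * s * x + 16 * s ^ 2) with hφ
  have hφc : Continuous φ := by rw [hφ]; fun_prop
  have hφ0 : φ 0 = x ^ 3 := by simp only [hφ]; ring
  have hφx : φ x = -(x ^ 3) := by simp only [hφ]; ring
  have hIVT := intermediate_value_Icc' hx.le hφc.continuousOn
  rw [hφx, hφ0] at hIVT
  obtain ⟨s, ⟨hs0, hsx⟩, hs⟩ := hIVT hr_mem
  -- `x` is a zero of `Φ_s`
  have hzero : F (x : ℂ) + P s (x : ℂ) * G (x : ℂ) = 0 := by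
    rw [hFx, hGx, P_ofReal]
    have hreal : f + φ s * g = 0 := by
      rw [hs, hr]; field_simp; ring
    have := congrArg (fun t : ℝ => (t : ℂ)) hreal
    simpa [hφ] using this
  -- the Wick condition puts `x ≤ s`, so `s = x` and `r = −x³`
  have hxs : x ≤ s := by simpa using (hW s hs0 (x : ℂ) hzero).2
  have hsx' : s = x := le_antisymm hsx hxs
  rw [hsx', hφx] at hs
  -- `hs : -(x^3) = r`, contradicting `|r| < x^3`
  have := (abs_lt.1 hr_abs).1
  linarith

end Summit.QuantumFields.YangMills.Cruxes.RationalToGeneral.HexagonNormalForm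

end
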